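import Summits.ResolutionOfSingularities.ResolutionOfSingularities.Theses.IndSmooth
import Summits.ResolutionOfSingularities.ResolutionOfSingularities.Theorems.ValuativeLuAlphaPTorsorDVR
import Summits.ResolutionOfSingularities.ResolutionOfSingularities.Theorems.IndSmoothSmoothToUniformizingDrSepBasis
import Summits.ResolutionOfSingularities.ResolutionOfSingularities.Theorems.IndSmoothSmoothToUniformizingDrHenselGenerator
import Summits.ResolutionOfSingularities.ResolutionOfSingularities.Theorems.IndSmoothSmoothToUniformizingDrRationalBase
import Summits.ResolutionOfSingularities.ResolutionOfSingularities.Theorems.IndSmoothSmoothToUniformizingDrAssembly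
import Literature.AlgebraicGeometry.Resolution.RankOneReduction
import HarnessLib

/-!
# The crux `IndSmooth.SmoothToUniformizing` holds along every DISCRETE valuation ring:
# relative local uniformization over a perfect field is TRUE, unconditionally, along every discrete
# valuation ring with residue field algebraic over the ground field
# (stmt-ResolutionOfSingularities-16088, line `birth`, branch DiscreteRange, TARGET `stub_discreteRange`)

Route `ResolutionOfSingularities/IndSmooth`, crux #3 `SmoothToUniformizing` (ind-smoothness of all
valuation rings of function fields over perfect fields of characteristic `p` ⇒ relative local
uniformization at `p`). This file lands a TRUE RANGE of the crux: its CONCLUSION — for `k` perfect,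
`K/k` finitely generated, `O ⊇ k` a valuation ring of `K` and `R ⊆ O` finitely generated, a finitely
generated `A` with `R ≤ A ⊆ O`, `Frac A = K`, `A` regular at the centre `𝔪_O ∩ A` — holds
OUTRIGHT (the ind-smoothness antecedent unused) whenever `O` is a DISCRETE VALUATION RING whose
residue field is ALGEBRAIC over `k` (the zero-dimensional discrete rank-one valuations: value group
`ℤ`, e.g. the order of vanishing along a transcendental formal arc), in EVERY dimension and EVERY
characteristic. For function fields of transcendence degree `≥ 2` these valuations are NOT
Abhyankar (rational rank `1` + residual transcendence degree `0` < trdeg), so this range is disjoint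
from Knaf–Kuhlmann 2005 / Temkin 2013 §5 (tree: `isLocallyUniformizable_of_transcendenceDefect_eq_zero`)
and from the essentially-finite-type case (`lurel_of_essFiniteType`); it is the elementary
"discrete zero-dimensional" case of Zariski 1940 carried out over a perfect field of any
characteristic by Knaf–Kuhlmann's method of henselian (inertial) generation.

Proof = the five registered sub-goals of the branch, all LANDED:
* `stub_dr_sepBasis` (`…DrSepBasis.lean`) — a separating transcendence basis `{t} ∪ s ⊆ O` of
  `K/k` containing the uniformizer `t` (Mac Lane: `t` is not a `p`-th power);
* `stub_dr_henselGenerator` (`…DrHenselGenerator.lean`, via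
  `Literature/…/DiscreteUnramifiedHenselGenerator.lean`) — `K = L(η)`, `L = k(t,s)`, with `η ∈ O`
  a HENSEL ROOT over `O ∩ L` (`O` is local-étale over the discrete valuation ring `O ∩ L`:
  `e = 1` as `t ∈ L`, separable residue extension over the perfect `k`, finite integral closure;
  Mathlib's local structure of unramified algebras);
* `stub_dr_rationalBase` (`…DrRationalBase.lean`, iterating `stub_dr_blowupStep` of
  `…DrBlowupStep.lean`, with `stub_dr_mvPolynomial_maximal_span` of `…DrMvPolynomialMaximal.lean`)
  — the rational base `k(t,s)` is uniformized above any finite set by ITERATED BLOW-UPS of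
  `k[t,s]` at the centre along `v` (the `t`-chart; values drop by one; regularity by counting
  generators of the centre against the dimension);
* `stub_dr_assembly` (`…DrAssembly.lean`) — Knaf–Kuhlmann 2009 Cor. 3.6 (tree
  `knafKuhlmann2009_cor36`) stacks the standard-étale top (`isSmoothlyUniformizableIn_of_henselRoot`)
  over the rational base, and strong smooth uniformizability is translated into the crux's
  conclusion for the given `R`;
* here: a uniformizer `t` of the discrete valuation ring `O`, "`t` is not a `p`-th power" from
  "`v(t)` generates the value group", and the chaining (`stub_discreteRange`).

Corollaries: `relLocalUniformization_of_isDiscreteValuationRing` (the tree's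
`RelLocalUniformization k K O` along such `O`) and `smoothToUniformizing_discreteRange` (the crux
restricted to this range of valuation rings).

References: O. Zariski, *Local uniformization on algebraic varieties*, Ann. of Math. 41 (1940),
§§ B.I (discrete zero-dimensional valuations); H. Knaf, F.-V. Kuhlmann, Ann. Sci. ÉNS 38 (2005)
§5 and Adv. Math. 221 (2009) Lemma 3.7, Cor. 3.6.
-/

noncomputable section

set_option linter.dupNamespace false

open IsLocalRing Polynomial
open Summit.ResolutionOfSingularities.ResolutionOfSingularities.Theses.IndSmooth (SmoothToUniformizing)
open Literature.AlgebraicGeometry.Resolution (RelLocalUniformization)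

namespace Summit.ResolutionOfSingularities.ResolutionOfSingularities.Theorems.IndSmoothBirth

/-- **Registered target `stub_discreteRange` — RELATIVE LOCAL UNIFORMIZATION OVER A PERFECT FIELD
ALONG EVERY DISCRETE VALUATION RING WITH RESIDUE FIELD ALGEBRAIC OVER THE GROUND FIELD.** For `k`
perfect of characteristic `p`, `K/k` finitely generated, `O ⊇ k` a valuation ring of `K` which is a
discrete valuation ring (`IsDiscreteValuationRing O`) and whose residues are algebraic over `k`
(every `x ∈ O` satisfies a monic polynomial over `k` up to `𝔪_O`), and `R ⊆ O` finitely generated: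
some finitely generated `A` with `R ≤ A ⊆ O`, `Frac A = K`, is regular at the centre `𝔪_O ∩ A`.
Chaining of the branch's landed sub-goals (module docstring). [folklore] -/
theorem stub_discreteRange (p : ℕ) (hp : p.Prime) (k K : Type) [Field k] [CharP k p] [PerfectField k]
    [Field K] [Algebra k K] (hK : (⊤ : IntermediateField k K).FG) (O : ValuationSubring K)
    (hO : ∀ c : k, algebraMap k K c ∈ O) (hdvr : IsDiscreteValuationRing O)
    (hres : ∀ x : K, x ∈ O → ∃ g : Polynomial k, g.Monic ∧ O.valuation (Polynomial.aeval x g) < 1)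
    (R : Subalgebra k K) (hR : R.FG) (hRO : R.toSubring ≤ O.toSubring) :
    ∃ (A : Subalgebra k K) (h : A.toSubring ≤ O.toSubring), R ≤ A ∧ A.FG ∧ IsFractionRing A K ∧
      IsRegularLocalRing (Localization.AtPrime
        (Ideal.comap (Subring.inclusion h) (IsLocalRing.maximalIdeal O))) := by
  classical
  haveI := hdvr
  -- a uniformizer
  obtain ⟨ϖ, hϖ⟩ := IsDiscreteValuationRing.exists_irreducible O
  set t : K := (ϖ : K) with ht
  have htO : t ∈ O := ϖ.2
  have hunif : ∀ x : K, x ≠ 0 → ∃ n : ℤ, O.valuation x = O.valuation t ^ n :=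
    fun x hx => PfaffLine.exists_zpow_valuation_of_isDiscreteValuationRing O hϖ x hx
  have hlt : O.valuation t < 1 :=
    (O.valuation_lt_one_iff ϖ).mp ((IsLocalRing.mem_maximalIdeal _).mpr hϖ.not_isUnit)
  have ht0 : t ≠ 0 := fun h0 => hϖ.ne_zero (Subtype.ext h0)
  -- `t` is not a `p`-th power (its value generates the value group)
  have hnp : ∀ u : K, u ^ p ≠ t := by
    intro u hu
    have hu0 : u ≠ 0 := by rintro rfl; exact ht0 (by rw [← hu, zero_pow hp.ne_zero])
    obtain ⟨n, hn⟩ := hunif u hu0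
    have e : O.valuation t = O.valuation t ^ (n * p) := by
      conv_lhs => rw [← hu, Valuation.map_pow, hn, ← zpow_natCast, ← zpow_mul]
    have hvt0 : O.valuation t ≠ 0 := (Valuation.ne_zero_iff _).mpr ht0
    have e' : O.valuation t ^ (n * p - 1) = 1 := by
      have h1 : O.valuation t ^ (n * p) = O.valuation t ^ (n * p - 1) * O.valuation t := by
        rw [← zpow_add_one₀ hvt0, sub_add_cancel]
      rw [h1] at e
      conv_lhs at e => rw [← one_mul (O.valuation t)]
      exact (mul_right_cancel₀ hvt0 e).symm
    -- `v(t)^m = 1` with `v(t) < 1` forces `m = 0`, but `n p - 1 ≠ 0`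
    have hm : (n * p - 1 : ℤ) ≠ 0 := by
      intro h0
      have : (n * p : ℤ) = 1 := by omega
      have hp2 : (2 : ℤ) ≤ p := by exact_mod_cast hp.two_le
      rcases le_or_gt n 0 with hn0 | hn0
      · nlinarith
      · nlinarith
    rcases lt_trichotomy (n * p - 1 : ℤ) 0 with hneg | hzero | hpos
    · have : 1 < O.valuation t ^ (n * p - 1) := one_lt_zpow_of_neg₀ (zero_lt_iff.mpr hvt0) hlt hneg
      rw [e'] at this; exact lt_irrefl _ this
    · exact hm hzero
    · have : O.valuation t ^ (n * p - 1) < 1 := zpow_lt_one₀ (zero_lt_iff.mpr hvt0) hlt hpos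
      rw [e'] at this; exact lt_irrefl _ this
  -- S1, S2, S3, S5
  obtain ⟨s, hts, hsO, hind, hsep, halg⟩ := stub_dr_sepBasis p hp k K hK O hO t htO hnp
  obtain ⟨η, hηO, hgen, f, hfmon, hfcoeff, hfη, hfder⟩ :=
    stub_dr_henselGenerator k K hK O hO t s htO hsO hsep halg hunif hlt hres
  exact stub_dr_assembly k K hK O hO t s htO hsO hind
    (fun Z hZ => stub_dr_rationalBase k K O hO t s htO hsO hts hind hunif hlt hres Z hZ)
    η hηO hgen f hfmon hfcoeff hfη hfder R hR hRO


/-- **Relative local uniformization (`RelLocalUniformization k K O`, the tree's Novacoski–Spivakovsky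
form) along every discrete valuation ring with residue field algebraic over a perfect ground
field**, in every dimension and characteristic. [folklore] -/
theorem relLocalUniformization_of_isDiscreteValuationRing (p : ℕ) (hp : p.Prime) (k K : Type)
    [Field k] [CharP k p] [PerfectField k] [Field K] [Algebra k K]
    (hK : (⊤ : IntermediateField k K).FG) (O : ValuationSubring K)
    (hO : ∀ c : k, algebraMap k K c ∈ O) (hdvr : IsDiscreteValuationRing O)
    (hres : ∀ x : K, x ∈ O → ∃ g : Polynomial k, g.Monic ∧ O.valuation (Polynomial.aeval x g) < 1) :
    RelLocalUniformization k K O := by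
  intro R hR _ hRO
  obtain ⟨A, h, hRA, hA, -, hreg⟩ := stub_discreteRange p hp k K hK O hO hdvr hres R hR hRO
  exact ⟨A, h, hRA, hA, hreg⟩

/-- **The crux `SmoothToUniformizing` holds on the discrete zero-dimensional range**: at every
prime `p`, WITHOUT using the ind-smoothness antecedent, its conclusion holds for every discrete
valuation ring `O` with residue field algebraic over the perfect ground field. [folklore] -/
theorem smoothToUniformizing_discreteRange :
    ∀ p : ℕ, p.Prime →
      (∀ (k K : Type) [Field k] [CharP k p] [PerfectField k] [Field K] [Algebra k K],
        (⊤ : IntermediateField k K).FG → ∀ O : ValuationSubring K, (∀ c : k, algebraMap k K c ∈ O) →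
        ∀ R : Subalgebra k K, R.FG → R.toSubring ≤ O.toSubring →
        ∃ (T : Type) (_ : CommRing T) (_ : Algebra k T), Algebra.Smooth k T ∧
          ∃ (ψ : R →ₐ[k] T) (χ : T →ₐ[k] K), (∀ t : T, χ t ∈ O) ∧ ∀ r : R, χ (ψ r) = (r : K)) →
      ∀ (k K : Type) [Field k] [CharP k p] [PerfectField k] [Field K] [Algebra k K],
        (⊤ : IntermediateField k K).FG → ∀ O : ValuationSubring K, (∀ c : k, algebraMap k K c ∈ O) →
        IsDiscreteValuationRing O →
        (∀ x : K, x ∈ O → ∃ g : Polynomial k, g.Monic ∧ O.valuation (Polynomial.aeval x g) < 1) →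
        ∀ R : Subalgebra k K, R.FG → R.toSubring ≤ O.toSubring →
        ∃ (A : Subalgebra k K) (h : A.toSubring ≤ O.toSubring), R ≤ A ∧ A.FG ∧ IsFractionRing A K ∧
          IsRegularLocalRing (Localization.AtPrime
            (Ideal.comap (Subring.inclusion h) (IsLocalRing.maximalIdeal O))) :=
  fun p hp _ k K _ _ _ _ _ hK O hO hdvr hres R hR hRO =>
    stub_discreteRange p hp k K hK O hO hdvr hres R hR hRO

end Summit.ResolutionOfSingularities.ResolutionOfSingularities.Theorems.IndSmoothBirth

end
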